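import Summits.HubbardSuperconductivity.HubbardSuperconductivity.Theorems.LiebTwinNoOnsiteODLROCouplingTransport
import Summits.HubbardSuperconductivity.HubbardSuperconductivity.Theorems.LiebTwinNoOnsiteODLROHartreeFockEnergyCeiling
import Literature.Barriers.HubbardSuperconductivity.PureModelStripeCompetitionProofs
import HarnessLib

/-!
# Crux `NoOnsiteODLRO` (stmt-HubbardSuperconductivity-0933), line `Sketch` — the HARTREE–FOCK ON-SITE CEILING:
# `S ≤ N²/2` for every repulsive ground state, i.e. `S_L/L⁴ ≤ (1−δ)²/2` window-free at every `U > 0`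

Helper file of lead c3 (route `LiebTwin`; the `EnslavedA1g` copy of the crux is `Iff.rfl`-equal), serving
`--supports stmt-HubbardSuperconductivity-0933` (registered helper stub `stub_hartreeFockOnsiteCeiling`). It combines
three landed pieces of the line's lever — the coupling-transport ceiling `(g/2L²)·S ≤ E(U) − E(U − g)`
(`Theorems.NoOnsiteODLRO.ReducedChannel.re_expect_pairField_sWave_le_couplingSecant`, seat LiebTwin-1), taken at
`g = U`, and the Hartree–Fock energy ceiling `E_(2n,0)(U) ≤ E_(2n,0)(0) + U·n²/L²`
(`Theorems.NoOnsiteODLRO.HartreeFock.hartreeFockEnergyCeiling`, wave 1 of this line, p158799) — into: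

* `re_expect_doublon_le_hartreeFock` — **every repulsive ground state has at most the Hartree–Fock number of
  doublons**: `Re⟨ψ, D ψ⟩ ≤ n²/L²` for every unit ground state `ψ` of the `(2n, 0)` sector of
  `hubbardTorus 2 L 1 U`, `U > 0` (`D = hubbardTorus 2 L 0 1 = Σ_x n_{x↑}n_{x↓}`; `ψ` is a trial state for the
  free torus: `U⟨D⟩ = E(U) − ⟨ψ,Tψ⟩ ≤ E(U) − E(0) ≤ U n²/L²`).
* `re_expect_onsite_le_two_mul_sq` — **the Hartree–Fock on-site ceiling**: `S := Re⟨ψ, P_sᴴP_s ψ⟩ ≤ 2n² = N²/2`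
  for the same `ψ` (coupling transport at `g = U` plus the energy ceiling), at EVERY finite `L ≥ 3`.
* `onsiteDensity_le_hartreeFock_of_admissible` — in the crux's vocabulary: along every admissible
  `(N_L, 0)`-sector ground-state sequence at `U > 0`, `δ ∈ [-1,1]`, for every even `L ≥ 3`,
  `S_L/L⁴ ≤ (1−δ)²/2`. This is a WINDOW-FREE, ALL-`U` density ceiling strictly below the trivial pseudospin
  value `(1−δ²)/2` (`0.32` vs `0.48` at `δ = 0.2`; `0.245–0.405` on the LiebTwin box `δ ∈ [0.1,0.3]`), the first
  nontrivial every-ground-state ceiling valid in the routes' box without a pair-window hypothesis (census B5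
  currency; compare `4δ(1−δ)/κ` GIVEN a window `κ`, p153034, and `128/(U − 144/√δ)²` for `U > 144/√δ`, p149426).
  It is NOT the crux (`∀ ε`): the lever `S ≤ 2L²·⟨D⟩` saturates at twice the doublon density (card of
  `NoOnsiteODLRO`: "what is missing is 'doublons do not Bose-condense at k = 0'").

Sources: D. R. Penn, Phys. Rev. 142 (1966) 350, §II (Hartree–Fock energy of the paramagnetic state);
B. S. Shastry, J. Phys. A 30 (1997) L635, eq. (1); R. B. Griffiths, J. Math. Phys. 5 (1964) 1215, §III;
C. N. Yang, Rev. Mod. Phys. 34 (1962) 694, §3; H. Tasaki, *Physics and Mathematics of Quantum Many-Body Systems*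
(2020) §2.2. Folklore bookkeeping on tree definitions; no definition, no named fact.
-/

noncomputable section

set_option linter.dupNamespace false

namespace Summit.HubbardSuperconductivity.HubbardSuperconductivity.Theorems.NoOnsiteODLRO.HartreeFock

open Matrix Finset
open Literature.Probability.LatticeModels Literature.MathematicalPhysics.QuantumLattice
open Summit.HubbardSuperconductivity.HubbardSuperconductivity.Theorems.NoOnsiteODLRO.ReducedChannel
  (re_expect_pairField_sWave_le_couplingSecant hubbardTorus_zero_one_eq_sum_doublon)
open scoped ComplexOrder

variable {L : ℕ} [NeZero L]

/-- **Repulsive ground states have at most the Hartree–Fock number of doublons.** For `L ≥ 3`, `U > 0`,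
`n ≤ L²` and every unit ground state `ψ` of `hubbardTorus 2 L 1 U` in the sector `(2n, S^z = 0)`:
`Re⟨ψ, D ψ⟩ ≤ n²/L²`, `D = hubbardTorus 2 L 0 1 = Σ_x n_{x↑}n_{x↓}`. Proof: `E(U) = ⟨ψ,H₀ψ⟩ + U⟨ψ,Dψ⟩`,
`⟨ψ,H₀ψ⟩ ≥ E(0)` (variational principle) and `E(U) ≤ E(0) + U n²/L²` (`hartreeFockEnergyCeiling`). The doublon
density of a repulsive ground state never exceeds the uncorrelated value `(n/L²)²` per site. Penn (1966) §II;
Griffiths (1964) §III. [folklore] -/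
theorem re_expect_doublon_le_hartreeFock (hL : 3 ≤ L) {U : ℝ} (hU : 0 < U) {n : ℕ} (hn : n ≤ L ^ 2)
    {ψ : Fock (Orb (FermionTorus 2 L))} (hψ1 : star ψ ⬝ᵥ ψ = 1)
    (hψ : IsGroundStateInSector (hubbardTorus 2 L 1 U) (2 * n) 0 ψ) :
    (expect (hubbardTorus 2 L 0 1) ψ).re ≤ (n : ℝ) ^ 2 / (L : ℝ) ^ 2 := by
  obtain ⟨hmem, -, heig⟩ := hψ
  have hH0 : (hubbardTorus 2 L 1 0).IsHermitian := LiebThm1.hamiltonian_isHermitian (fermionTorusGraph 2 L) 1 0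
  -- `E(U) = Re⟨ψ, H_U ψ⟩ = Re⟨ψ, H₀ ψ⟩ + U · Re⟨ψ, D ψ⟩`
  have hEU : (star ψ ⬝ᵥ (hubbardTorus 2 L 1 U) *ᵥ ψ).re =
      (hubbardTorus 2 L 1 U).minEnergyOn (szSector (Λ := FermionTorus 2 L) (2 * n) 0) := by
    rw [heig, dotProduct_smul, hψ1, smul_eq_mul, mul_one, Complex.ofReal_re]
  have hsplit : hubbardTorus 2 L 1 U = hubbardTorus 2 L 1 0 + (U : ℂ) • hubbardTorus 2 L 0 1 := by
    rw [hubbardTorus_eq_zero_add_smul_interaction (L := L) U, hubbardTorus_zero_one_eq_sum_doublon]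
  have hexp : (star ψ ⬝ᵥ (hubbardTorus 2 L 1 U) *ᵥ ψ).re =
      (star ψ ⬝ᵥ (hubbardTorus 2 L 1 0) *ᵥ ψ).re + U * (expect (hubbardTorus 2 L 0 1) ψ).re := by
    rw [hsplit, add_mulVec, dotProduct_add, Complex.add_re, smul_mulVec, dotProduct_smul, smul_eq_mul,
      Complex.re_ofReal_mul]
    rfl
  -- variational principle at `U = 0` and the Hartree–Fock energy ceiling at `U`
  have hvar := minEnergyOn_le_rayleigh_of_mem hH0 (szSector (Λ := FermionTorus 2 L) (2 * n) 0) hmem hψ1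
  have hHF := hartreeFockEnergyCeiling hL U hn
  have key : U * (expect (hubbardTorus 2 L 0 1) ψ).re ≤ U * ((n : ℝ) ^ 2 / (L : ℝ) ^ 2) := by linarith
  exact le_of_mul_le_mul_left key hU

/-- **The Hartree–Fock on-site ceiling.** For `L ≥ 3`, `U > 0`, `n ≤ L²` and every unit ground state `ψ` of
`hubbardTorus 2 L 1 U` in the sector `(2n, S^z = 0)`: `Re⟨ψ, P_sᴴP_s ψ⟩ ≤ 2n² = N²/2`
(`P_s = pairField sWave L = √2 Σ_x c_{x↑}c_{x↓}`). Proof: the coupling-transport ceiling at `g = U`,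
`(U/2L²)·S ≤ E(U) − E(0)`, and `E(U) − E(0) ≤ U n²/L²`. Equivalently `S ≤ 2L²·(n/L²)²·L²`: the on-site pair
structure factor is at most `2L²` times the Hartree–Fock doublon number. Shastry (1997) eq. (1); Penn (1966)
§II; Yang (1962) §3. [folklore] -/
theorem re_expect_onsite_le_two_mul_sq (hL : 3 ≤ L) {U : ℝ} (hU : 0 < U) {n : ℕ} (hn : n ≤ L ^ 2)
    {ψ : Fock (Orb (FermionTorus 2 L))} (hψ1 : star ψ ⬝ᵥ ψ = 1)
    (hψ : IsGroundStateInSector (hubbardTorus 2 L 1 U) (2 * n) 0 ψ) :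
    (expect ((pairField sWave L)ᴴ * pairField sWave L) ψ).re ≤ 2 * (n : ℝ) ^ 2 := by
  have h1 := re_expect_pairField_sWave_le_couplingSecant L U hU (2 * n) 0 hψ1 hψ
  rw [sub_self] at h1
  have hHF := hartreeFockEnergyCeiling hL U hn
  have hL1 : (0 : ℝ) < (L : ℝ) := by exact_mod_cast Nat.pos_of_ne_zero (NeZero.ne L)
  have hL2 : (0 : ℝ) < (L : ℝ) ^ 2 := by positivity
  set S := (expect ((pairField sWave L)ᴴ * pairField sWave L) ψ).re
  -- `(U / 2L²)·S ≤ U n²/L²`, hence `U·S ≤ U·2n²`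
  have key : U / (2 * (L : ℝ) ^ 2) * S ≤ U * ((n : ℝ) ^ 2 / (L : ℝ) ^ 2) := by linarith
  have key2 : U * S ≤ U * (2 * (n : ℝ) ^ 2) := by
    have h := mul_le_mul_of_nonneg_left key (by positivity : (0 : ℝ) ≤ 2 * (L : ℝ) ^ 2)
    calc U * S = 2 * (L : ℝ) ^ 2 * (U / (2 * (L : ℝ) ^ 2) * S) := by field_simp
      _ ≤ 2 * (L : ℝ) ^ 2 * (U * ((n : ℝ) ^ 2 / (L : ℝ) ^ 2)) := h
      _ = U * (2 * (n : ℝ) ^ 2) := by field_simp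
  exact le_of_mul_le_mul_left key2 hU

omit [NeZero L] in
/-- The summit's electron number is at most `(1 − δ)L²/2` pairs: `⌊(1−δ)L²/2⌋ ≤ (1−δ)L²/2` for `δ ≤ 1`.
[folklore] -/
theorem natFloor_filling_le_half {δ : ℝ} (hδ : δ ≤ 1) (L : ℕ) :
    (⌊(1 - δ) * (L : ℝ) ^ 2 / 2⌋₊ : ℝ) ≤ (1 - δ) * (L : ℝ) ^ 2 / 2 := by
  refine Nat.floor_le ?_
  have hL : (0 : ℝ) ≤ (L : ℝ) ^ 2 := by positivity
  have : 0 ≤ (1 - δ) * (L : ℝ) ^ 2 := mul_nonneg (by linarith) hL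
  linarith

omit [NeZero L] in
/-- **The Hartree–Fock density ceiling in the crux's vocabulary.** For `U > 0`, `δ ∈ [-1, 1]` and every sequence
`(N, ψ)` admissible for `NoOnsiteODLRO` (`N_L = 2⌊(1−δ)L²/2⌋`, `ψ_L` a normalised `(N_L, 0)`-sector ground state
of `hubbardTorus 2 L 1 U` at every even `L`): for every even `L ≥ 3`,
`Re⟨ψ_L, P_sᴴP_s ψ_L⟩ / L⁴ ≤ (1 − δ)²/2` — window-free, uniform in `U > 0`, strictly below the trivial
pseudospin bound `(1 − δ²)/2` for `δ ∈ (0,1)`. Not the crux: a density ceiling (`LRO_s ≤ 2 × doublon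
density ≤ 2 × its Hartree–Fock value`). Penn (1966) §II; Shastry (1997) eq. (1); Yang (1962) §3. [folklore] -/
theorem onsiteDensity_le_hartreeFock_of_admissible {U δ : ℝ} (hU : 0 < U) (hδ₁ : -1 ≤ δ) (hδ : δ ≤ 1)
    {N : ℕ → ℕ} {ψ : ∀ L, Fock (Orb (FermionTorus 2 L))}
    (hyp : ∀ L, Even L → N L = 2 * ⌊(1 - δ) * (L : ℝ) ^ 2 / 2⌋₊ ∧ star (ψ L) ⬝ᵥ ψ L = 1 ∧
      IsGroundStateInSector (hubbardTorus 2 L 1 U) (N L) 0 (ψ L))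
    (L : ℕ) [NeZero L] (hEv : Even L) (hL : 3 ≤ L) :
    (expect ((pairField sWave L)ᴴ * pairField sWave L) (ψ L)).re / (L : ℝ) ^ 4 ≤ (1 - δ) ^ 2 / 2 := by
  obtain ⟨hN, hψ1, hGS⟩ := hyp L hEv
  rw [hN] at hGS
  have hn : ⌊(1 - δ) * (L : ℝ) ^ 2 / 2⌋₊ ≤ L ^ 2 := Literature.Barriers.HubbardSuperconductivity.natFloor_filling_le_sq hδ₁ L
  have hS := re_expect_onsite_le_two_mul_sq hL hU hn hψ1 hGS
  have hfl := natFloor_filling_le_half hδ L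
  have hfl0 : (0 : ℝ) ≤ (⌊(1 - δ) * (L : ℝ) ^ 2 / 2⌋₊ : ℝ) := Nat.cast_nonneg _
  have hL1 : (0 : ℝ) < (L : ℝ) := by exact_mod_cast Nat.pos_of_ne_zero (NeZero.ne L)
  have hL4 : (0 : ℝ) < (L : ℝ) ^ 4 := by positivity
  rw [div_le_iff₀ hL4]
  have hsq : (⌊(1 - δ) * (L : ℝ) ^ 2 / 2⌋₊ : ℝ) ^ 2 ≤ ((1 - δ) * (L : ℝ) ^ 2 / 2) ^ 2 :=
    pow_le_pow_left₀ hfl0 hfl 2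
  calc (expect ((pairField sWave L)ᴴ * pairField sWave L) (ψ L)).re
      ≤ 2 * (⌊(1 - δ) * (L : ℝ) ^ 2 / 2⌋₊ : ℝ) ^ 2 := hS
    _ ≤ 2 * ((1 - δ) * (L : ℝ) ^ 2 / 2) ^ 2 := by linarith
    _ = (1 - δ) ^ 2 / 2 * (L : ℝ) ^ 4 := by ring

/-! ### Registered helper stub -/

/-- **Registered helper stub `stub_hartreeFockOnsiteCeiling`** of crux `NoOnsiteODLRO` (stmt-HubbardSuperconductivity-0933,
line `Sketch`; NOT a composition piece): the finite-`L` Hartree–Fock on-site ceiling `S ≤ 2n²` for every unit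
ground state of the `(2n,0)` sector at `U > 0` (`re_expect_onsite_le_two_mul_sq` with all binders after the colon).
[folklore] -/
theorem stub_hartreeFockOnsiteCeiling : open Literature.MathematicalPhysics.QuantumLattice Literature.Probability.LatticeModels in ∀ (L : ℕ) [NeZero L], 3 ≤ L → ∀ (U : ℝ), 0 < U → ∀ (n : ℕ), n ≤ L ^ 2 → ∀ (ψ : Fock (Orb (FermionTorus 2 L))), star ψ ⬝ᵥ ψ = 1 → IsGroundStateInSector (hubbardTorus 2 L 1 U) (2 * n) 0 ψ → (expect ((pairField sWave L)ᴴ * pairField sWave L) ψ).re ≤ 2 * (n : ℝ) ^ 2 :=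
  fun _ _ hL _ hU _ hn _ hψ1 hψ => re_expect_onsite_le_two_mul_sq hL hU hn hψ1 hψ

end Summit.HubbardSuperconductivity.HubbardSuperconductivity.Theorems.NoOnsiteODLRO.HartreeFock

end
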